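import Summits.Langlands.Langlands.Theorems.RationalPeriodQuarterCocycleLinear
import Summits.Langlands.Langlands.Theorems.RationalPeriodQuarterProjectionPrelim

/-!
# `RationalPeriodQuarter` — linear-combination closure lemmas (child A of `HeckeFieldOfCruxes`, support)

Support for `RationalPeriodQuarter.HeckeFieldOfCruxes` (stmt-Langlands-10432), seed node `HeckeFieldOfCruxesSplit`,
child A `RationalFormsInjectivity`.  Closure under finite linear combinations of: the route's inlined quarter cusp form
predicate (`C²`, `Γ₁(N)`-invariance, `(Δ + 1/4) u = 0` via linearity of the Laplacian on `C²` functions, boundedness);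
the inlined `PR_ℚ` class under `ℚ`-combinations and `PR_ℚ → PR_ℂ` under `ℂ`-combinations (common denominators);
semi-analyticity (sums, differences, and `PR_ℂ ⇒` semi-analytic); cofinite sets under determinant-one Möbius pull-back;
and the coefficient bookkeeping `g = r • e` with `e` `ℚ`-independent, `r` rational.
-/

set_option linter.dupNamespace false

namespace Summit.Langlands.Langlands.Theorems

open scoped BigOperators Topology
open Filter Set Polynomial

open Literature.NumberTheory.Automorphic InnerProductSpace

/-! ### Quarter cusp forms are closed under linear combinations -/

/-- `C²` on the open upper half-plane gives `C²` at each point of `ℍ`. -/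
theorem rpq_contDiffAt_of_isC2 (u : UpperHalfPlane → ℂ) (hu : IsC2 u) (z : UpperHalfPlane) :
    ContDiffAt ℝ 2 (u ∘ UpperHalfPlane.ofComplex) (z : ℂ) :=
  hu.contDiffAt ((isOpen_lt continuous_const Complex.continuous_im).mem_nhds z.im_pos)

/-- Additivity of the hyperbolic Laplacian on `C²` functions. -/
theorem rpq_hypLaplacian_add (u v : UpperHalfPlane → ℂ) (hu : IsC2 u) (hv : IsC2 v) (z : UpperHalfPlane) :
    hypLaplacian (u + v) z = hypLaplacian u z + hypLaplacian v z := by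
  unfold hypLaplacian
  have : ((u + v) ∘ UpperHalfPlane.ofComplex : ℂ → ℂ) =
      (u ∘ UpperHalfPlane.ofComplex) + (v ∘ UpperHalfPlane.ofComplex) := rfl
  rw [this, ContDiffAt.laplacian_add (rpq_contDiffAt_of_isC2 u hu z) (rpq_contDiffAt_of_isC2 v hv z), mul_add]

/-- Homogeneity of the hyperbolic Laplacian on `C²` functions. -/
theorem rpq_hypLaplacian_smul (c : ℂ) (u : UpperHalfPlane → ℂ) (hu : IsC2 u) (z : UpperHalfPlane) :
    hypLaplacian (c • u) z = c * hypLaplacian u z := by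
  unfold hypLaplacian
  have : ((c • u) ∘ UpperHalfPlane.ofComplex : ℂ → ℂ) = c • (u ∘ UpperHalfPlane.ofComplex) := rfl
  rw [this, laplacian_smul c (rpq_contDiffAt_of_isC2 u hu z), smul_eq_mul, mul_left_comm]

/-- The hyperbolic Laplacian of the zero function vanishes. -/
theorem rpq_hypLaplacian_zero (z : UpperHalfPlane) : hypLaplacian (0 : UpperHalfPlane → ℂ) z = 0 :=
  hypLaplacian_const 0 z

/-- The hyperbolic Laplacian of a finite linear combination of `C²` functions. -/
theorem rpq_hypLaplacian_linComb {ι : Type*} (s : Finset ι) (c : ι → ℂ) (v : ι → UpperHalfPlane → ℂ)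
    (hv : ∀ j ∈ s, IsC2 (v j)) (z : UpperHalfPlane) :
    hypLaplacian (∑ j ∈ s, c j • v j) z = ∑ j ∈ s, c j * hypLaplacian (v j) z := by
  classical
  induction s using Finset.induction_on with
  | empty => simp [rpq_hypLaplacian_zero]
  | insert a s ha ih =>
    have ha' : IsC2 (v a) := hv a (Finset.mem_insert_self a s)
    have hs' : ∀ j ∈ s, IsC2 (v j) := fun j hj => hv j (Finset.mem_insert_of_mem hj)
    rw [Finset.sum_insert ha, Finset.sum_insert ha,
      rpq_hypLaplacian_add _ _ (isC2_smul' _ _ ha') (isC2_linComb s c v hs'),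
      rpq_hypLaplacian_smul _ _ ha', ih hs']

/-- Finite linear combinations of quarter cusp forms on `Γ₁(N)` (route's inlined `IsQuarterCuspForm`) are again such. -/
theorem rpq_quarter_linComb {ι : Type*} (N : ℕ) (s : Finset ι) (c : ι → ℂ) (v : ι → UpperHalfPlane → ℂ)
    (hv : ∀ j ∈ s, IsC2 (v j) ∧ (∀ γ ∈ CongruenceSubgroup.Gamma1 N, ∀ z : UpperHalfPlane, v j (γ • z) = v j z) ∧
      (∀ z : UpperHalfPlane, hypLaplacian (v j) z + (1 / 4 : ℂ) * v j z = 0) ∧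
      ∃ C : ℝ, ∀ z : UpperHalfPlane, ‖v j z‖ ≤ C) :
    IsC2 (∑ j ∈ s, c j • v j) ∧
      (∀ γ ∈ CongruenceSubgroup.Gamma1 N, ∀ z : UpperHalfPlane,
        (∑ j ∈ s, c j • v j) (γ • z) = (∑ j ∈ s, c j • v j) z) ∧
      (∀ z : UpperHalfPlane,
        hypLaplacian (∑ j ∈ s, c j • v j) z + (1 / 4 : ℂ) * (∑ j ∈ s, c j • v j) z = 0) ∧
      ∃ C : ℝ, ∀ z : UpperHalfPlane, ‖(∑ j ∈ s, c j • v j) z‖ ≤ C := by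
  classical
  have hC2 : ∀ j ∈ s, IsC2 (v j) := fun j hj => (hv j hj).1
  refine ⟨isC2_linComb s c v hC2, fun γ hγ z => ?_, fun z => ?_, ?_⟩
  · simp only [Finset.sum_apply, Pi.smul_apply, smul_eq_mul]
    exact Finset.sum_congr rfl fun j hj => by rw [(hv j hj).2.1 γ hγ z]
  · rw [rpq_hypLaplacian_linComb s c v hC2 z]
    simp only [Finset.sum_apply, Pi.smul_apply, smul_eq_mul, Finset.mul_sum]
    rw [← Finset.sum_add_distrib]
    refine Finset.sum_eq_zero fun j hj => ?_
    have h := (hv j hj).2.2.1 z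
    calc c j * hypLaplacian (v j) z + 1 / 4 * (c j * v j z)
        = c j * (hypLaplacian (v j) z + 1 / 4 * v j z) := by ring
      _ = 0 := by rw [h, mul_zero]
  · have hb : ∀ j ∈ s, ∃ C : ℝ, ∀ z : UpperHalfPlane, ‖v j z‖ ≤ C := fun j hj => (hv j hj).2.2.2
    choose! C hC using hb
    refine ⟨∑ j ∈ s, ‖c j‖ * C j, fun z => ?_⟩
    simp only [Finset.sum_apply, Pi.smul_apply, smul_eq_mul]
    refine (norm_sum_le _ _).trans (Finset.sum_le_sum fun j hj => ?_)
    rw [norm_mul]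
    exact mul_le_mul_of_nonneg_left (hC j hj z) (norm_nonneg _)

/-! ### Linear combinations of piecewise-rational functions -/

/-- Evaluation identity for a combination of fractions over a common denominator. -/
theorem rpq_sum_frac_eval {ι : Type*} [DecidableEq ι] (s : Finset ι) (e : ι → ℂ) (P Q : ι → ℂ[X]) (x : ℂ)
    (hQ : ∀ j ∈ s, (Q j).eval x ≠ 0) :
    ∑ j ∈ s, e j * ((P j).eval x / (Q j).eval x) =
      (∑ j ∈ s, C (e j) * P j * ∏ i ∈ s.erase j, Q i).eval x / (∏ j ∈ s, Q j).eval x := by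
  have hD : (∏ j ∈ s, Q j).eval x ≠ 0 := by
    rw [eval_prod]; exact Finset.prod_ne_zero_iff.2 hQ
  rw [eq_div_iff hD, Finset.sum_mul, eval_finsetSum]
  refine Finset.sum_congr rfl fun j hj => ?_
  have hq := hQ j hj
  rw [← Finset.prod_erase_mul s Q hj]
  simp only [eval_mul, eval_C]
  rw [mul_div_assoc', div_mul_eq_mul_div, div_eq_iff hq]
  ring

/-- A `ℚ`-combination of functions with rational-fraction representations on a common domain has one. -/
theorem rpq_comb_clause_rat {ι : Type*} (s : Finset ι) (r : ι → ℚ) (φ : ι → ℝ → ℂ) (Dm : ℝ → Prop)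
    (h : ∀ j ∈ s, ∃ P Q : ℚ[X], ∀ x : ℝ, Dm x →
      Polynomial.aeval (x : ℂ) Q ≠ 0 ∧ φ j x = Polynomial.aeval (x : ℂ) P / Polynomial.aeval (x : ℂ) Q) :
    ∃ P Q : ℚ[X], ∀ x : ℝ, Dm x → Polynomial.aeval (x : ℂ) Q ≠ 0 ∧
      (∑ j ∈ s, (r j : ℂ) * φ j x) = Polynomial.aeval (x : ℂ) P / Polynomial.aeval (x : ℂ) Q := by
  classical
  choose! P Q hPQ using h
  refine ⟨∑ j ∈ s, C (r j) * P j * ∏ i ∈ s.erase j, Q i, ∏ j ∈ s, Q j, fun x hx => ?_⟩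
  have hQ : ∀ j ∈ s, ((Q j).map (algebraMap ℚ ℂ)).eval (x : ℂ) ≠ 0 := fun j hj => by
    rw [← rpq_aeval_eq_eval_map]; exact (hPQ j hj x hx).1
  refine ⟨?_, ?_⟩
  · rw [rpq_aeval_eq_eval_map, Polynomial.map_prod, eval_prod]; exact Finset.prod_ne_zero_iff.2 hQ
  · have hs : ∑ j ∈ s, (r j : ℂ) * φ j x = ∑ j ∈ s, (r j : ℂ) *
        (((P j).map (algebraMap ℚ ℂ)).eval (x : ℂ) / ((Q j).map (algebraMap ℚ ℂ)).eval (x : ℂ)) :=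
      Finset.sum_congr rfl fun j hj => by rw [(hPQ j hj x hx).2, rpq_aeval_eq_eval_map, rpq_aeval_eq_eval_map]
    rw [hs, rpq_sum_frac_eval s (fun j => (r j : ℂ)) _ _ (x : ℂ) hQ, rpq_aeval_eq_eval_map, rpq_aeval_eq_eval_map]
    simp only [Polynomial.map_sum, Polynomial.map_mul, Polynomial.map_prod, Polynomial.map_C, eq_ratCast]

/-- A `ℂ`-combination of functions with rational-fraction representations on a common domain has a
representation with complex numerator and rational denominator. -/
theorem rpq_comb_clause_C {ι : Type*} (s : Finset ι) (e : ι → ℂ) (φ : ι → ℝ → ℂ) (Dm : ℝ → Prop)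
    (h : ∀ j ∈ s, ∃ P Q : ℚ[X], ∀ x : ℝ, Dm x →
      Polynomial.aeval (x : ℂ) Q ≠ 0 ∧ φ j x = Polynomial.aeval (x : ℂ) P / Polynomial.aeval (x : ℂ) Q) :
    ∃ (P : ℂ[X]) (Q : ℚ[X]), ∀ x : ℝ, Dm x → Polynomial.aeval (x : ℂ) Q ≠ 0 ∧
      (∑ j ∈ s, e j * φ j x) = P.eval (x : ℂ) / Polynomial.aeval (x : ℂ) Q := by
  classical
  choose! P Q hPQ using h
  refine ⟨∑ j ∈ s, C (e j) * (P j).map (algebraMap ℚ ℂ) * ∏ i ∈ s.erase j, (Q i).map (algebraMap ℚ ℂ),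
    ∏ j ∈ s, Q j, fun x hx => ?_⟩
  have hQ : ∀ j ∈ s, ((Q j).map (algebraMap ℚ ℂ)).eval (x : ℂ) ≠ 0 := fun j hj => by
    rw [← rpq_aeval_eq_eval_map]; exact (hPQ j hj x hx).1
  refine ⟨?_, ?_⟩
  · rw [rpq_aeval_eq_eval_map, Polynomial.map_prod, eval_prod]; exact Finset.prod_ne_zero_iff.2 hQ
  · have hs : ∑ j ∈ s, e j * φ j x = ∑ j ∈ s, e j *
        (((P j).map (algebraMap ℚ ℂ)).eval (x : ℂ) / ((Q j).map (algebraMap ℚ ℂ)).eval (x : ℂ)) :=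
      Finset.sum_congr rfl fun j hj => by rw [(hPQ j hj x hx).2, rpq_aeval_eq_eval_map, rpq_aeval_eq_eval_map]
    rw [hs, rpq_sum_frac_eval s e _ _ (x : ℂ) hQ, rpq_aeval_eq_eval_map, Polynomial.map_prod]

/-- Bound bookkeeping: `B j ≤ ∑ |B i|`. -/
theorem rpq_le_sum_abs {ι : Type*} (s : Finset ι) (B : ι → ℚ) {j : ι} (hj : j ∈ s) :
    ((B j : ℚ) : ℝ) ≤ ((∑ i ∈ s, |B i| : ℚ) : ℝ) := by
  exact_mod_cast (le_abs_self (B j)).trans (Finset.single_le_sum (fun i _ => abs_nonneg (B i)) hj)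

/-- `ℚ`-linear combinations of `PR_ℚ` functions (route's inlined `IsPRQ`) are `PR_ℚ`. -/
theorem rpq_isPRQ_linComb {ι : Type*} (s : Finset ι) (r : ι → ℚ) (φ : ι → ℝ → ℂ)
    (hφ : ∀ j ∈ s, (∃ F : Finset ℚ, (∀ a b : ℚ, a < b → (∀ r ∈ F, r ≤ a ∨ b ≤ r) → ∃ P Q : Polynomial ℚ, ∀ x : ℝ, (a : ℝ) < x → x < b → Polynomial.aeval (x : ℂ) Q ≠ 0 ∧ φ j x = Polynomial.aeval (x : ℂ) P / Polynomial.aeval (x : ℂ) Q) ∧ ∃ B : ℚ, (∃ P Q : Polynomial ℚ, ∀ x : ℝ, (B : ℝ) < x → Polynomial.aeval (x : ℂ) Q ≠ 0 ∧ φ j x = Polynomial.aeval (x : ℂ) P / Polynomial.aeval (x : ℂ) Q) ∧ (∃ P Q : Polynomial ℚ, ∀ x : ℝ, x < -(B : ℝ) → Polynomial.aeval (x : ℂ) Q ≠ 0 ∧ φ j x = Polynomial.aeval (x : ℂ) P / Polynomial.aeval (x : ℂ) Q))) :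
    (∃ F : Finset ℚ, (∀ a b : ℚ, a < b → (∀ r ∈ F, r ≤ a ∨ b ≤ r) → ∃ P Q : Polynomial ℚ, ∀ x : ℝ, (a : ℝ) < x → x < b → Polynomial.aeval (x : ℂ) Q ≠ 0 ∧ (∑ j ∈ s, (r j : ℂ) * φ j x) = Polynomial.aeval (x : ℂ) P / Polynomial.aeval (x : ℂ) Q) ∧ ∃ B : ℚ, (∃ P Q : Polynomial ℚ, ∀ x : ℝ, (B : ℝ) < x → Polynomial.aeval (x : ℂ) Q ≠ 0 ∧ (∑ j ∈ s, (r j : ℂ) * φ j x) = Polynomial.aeval (x : ℂ) P / Polynomial.aeval (x : ℂ) Q) ∧ (∃ P Q : Polynomial ℚ, ∀ x : ℝ, x < -(B : ℝ) → Polynomial.aeval (x : ℂ) Q ≠ 0 ∧ (∑ j ∈ s, (r j : ℂ) * φ j x) = Polynomial.aeval (x : ℂ) P / Polynomial.aeval (x : ℂ) Q)) := by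
  classical
  choose! F hF B hR hL using hφ
  refine ⟨s.biUnion F, fun a b hab havoid => ?_, ∑ j ∈ s, |B j|, ?_, ?_⟩
  · obtain ⟨P, Q, h⟩ := rpq_comb_clause_rat s r φ (fun x => (a : ℝ) < x ∧ x < b) fun j hj => by
      obtain ⟨P, Q, h⟩ := hF j hj a b hab fun q hq => havoid q (Finset.mem_biUnion.2 ⟨j, hj, hq⟩)
      exact ⟨P, Q, fun x hx => h x hx.1 hx.2⟩
    exact ⟨P, Q, fun x h1 h2 => h x ⟨h1, h2⟩⟩
  · obtain ⟨P, Q, h⟩ := rpq_comb_clause_rat s r φ (fun x => ((∑ j ∈ s, |B j| : ℚ) : ℝ) < x) fun j hj => by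
      obtain ⟨P, Q, h⟩ := hR j hj
      exact ⟨P, Q, fun x hx => h x (lt_of_le_of_lt (rpq_le_sum_abs s B hj) hx)⟩
    exact ⟨P, Q, h⟩
  · obtain ⟨P, Q, h⟩ := rpq_comb_clause_rat s r φ (fun x => x < -(((∑ j ∈ s, |B j| : ℚ) : ℝ))) fun j hj => by
      obtain ⟨P, Q, h⟩ := hL j hj
      refine ⟨P, Q, fun x hx => h x (lt_of_lt_of_le hx ?_)⟩
      have h1 : ((-|B j| : ℚ) : ℝ) ≤ -((B j : ℚ) : ℝ) := by exact_mod_cast neg_le_neg (le_abs_self (B j))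
      have h2 : -(((∑ j ∈ s, |B j| : ℚ) : ℝ)) ≤ ((-|B j| : ℚ) : ℝ) := by
        have := Finset.single_le_sum (fun i _ => abs_nonneg (B i)) hj
        push_cast; exact_mod_cast neg_le_neg this
      exact h2.trans h1
    exact ⟨P, Q, h⟩

/-- `ℂ`-linear combinations of `PR_ℚ` functions are `PR_ℂ` (route's inlined `IsPRC`). -/
theorem rpq_isPRC_linComb {ι : Type*} (s : Finset ι) (e : ι → ℂ) (φ : ι → ℝ → ℂ)
    (hφ : ∀ j ∈ s, (∃ F : Finset ℚ, (∀ a b : ℚ, a < b → (∀ r ∈ F, r ≤ a ∨ b ≤ r) → ∃ P Q : Polynomial ℚ, ∀ x : ℝ, (a : ℝ) < x → x < b → Polynomial.aeval (x : ℂ) Q ≠ 0 ∧ φ j x = Polynomial.aeval (x : ℂ) P / Polynomial.aeval (x : ℂ) Q) ∧ ∃ B : ℚ, (∃ P Q : Polynomial ℚ, ∀ x : ℝ, (B : ℝ) < x → Polynomial.aeval (x : ℂ) Q ≠ 0 ∧ φ j x = Polynomial.aeval (x : ℂ) P / Polynomial.aeval (x : ℂ) Q) ∧ (∃ P Q : Polynomial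 ℚ, ∀ x : ℝ, x < -(B : ℝ) → Polynomial.aeval (x : ℂ) Q ≠ 0 ∧ φ j x = Polynomial.aeval (x : ℂ) P / Polynomial.aeval (x : ℂ) Q))) :
    (∃ F : Finset ℚ, (∀ a b : ℚ, a < b → (∀ r ∈ F, r ≤ a ∨ b ≤ r) → ∃ (P : Polynomial ℂ) (Q : Polynomial ℚ), ∀ x : ℝ, (a : ℝ) < x → x < b → Polynomial.aeval (x : ℂ) Q ≠ 0 ∧ (∑ j ∈ s, e j * φ j x) = Polynomial.eval (x : ℂ) P / Polynomial.aeval (x : ℂ) Q) ∧ ∃ B : ℚ, (∃ (P : Polynomial ℂ) (Q : Polynomial ℚ), ∀ x : ℝ, (B : ℝ) < x → Polynomial.aeval (x : ℂ) Q ≠ 0 ∧ (∑ j ∈ s, e j * φ j x) = Polynomial.eval (x : ℂ) P / Polynomial.aeval (x : ℂ) Q) ∧ (∃ (P : Polynomial ℂ) (Q : Polynomial ℚ), ∀ x : ℝ, x < -(B : ℝ) → Polynomial.aeval (x : ℂ) Q ≠ 0 ∧ (∑ j ∈ s, e j * φ j x) = Polynomial.eval (x : ℂ) P / Polynomial.aeval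 (x : ℂ) Q)) := by
  classical
  choose! F hF B hR hL using hφ
  refine ⟨s.biUnion F, fun a b hab havoid => ?_, ∑ j ∈ s, |B j|, ?_, ?_⟩
  · obtain ⟨P, Q, h⟩ := rpq_comb_clause_C s e φ (fun x => (a : ℝ) < x ∧ x < b) fun j hj => by
      obtain ⟨P, Q, h⟩ := hF j hj a b hab fun q hq => havoid q (Finset.mem_biUnion.2 ⟨j, hj, hq⟩)
      exact ⟨P, Q, fun x hx => h x hx.1 hx.2⟩
    exact ⟨P, Q, fun x h1 h2 => h x ⟨h1, h2⟩⟩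
  · obtain ⟨P, Q, h⟩ := rpq_comb_clause_C s e φ (fun x => ((∑ j ∈ s, |B j| : ℚ) : ℝ) < x) fun j hj => by
      obtain ⟨P, Q, h⟩ := hR j hj
      exact ⟨P, Q, fun x hx => h x (lt_of_le_of_lt (rpq_le_sum_abs s B hj) hx)⟩
    exact ⟨P, Q, h⟩
  · obtain ⟨P, Q, h⟩ := rpq_comb_clause_C s e φ (fun x => x < -(((∑ j ∈ s, |B j| : ℚ) : ℝ))) fun j hj => by
      obtain ⟨P, Q, h⟩ := hL j hj
      refine ⟨P, Q, fun x hx => h x (lt_of_lt_of_le hx ?_)⟩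
      have h1 : ((-|B j| : ℚ) : ℝ) ≤ -((B j : ℚ) : ℝ) := by exact_mod_cast neg_le_neg (le_abs_self (B j))
      have h2 : -(((∑ j ∈ s, |B j| : ℚ) : ℝ)) ≤ ((-|B j| : ℚ) : ℝ) := by
        have := Finset.single_le_sum (fun i _ => abs_nonneg (B i)) hj
        push_cast; exact_mod_cast neg_le_neg this
      exact h2.trans h1
    exact ⟨P, Q, h⟩

/-! ### Semi-analytic functions -/

/-- Finite `ℂ`-combinations of semi-analytic functions are semi-analytic. -/
theorem rpq_semiAnalytic_linComb {ι : Type*} (s : Finset ι) (e : ι → ℂ) (f : ι → ℝ → ℂ)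
    (hf : ∀ j ∈ s, ∃ F : Finset ℝ, AnalyticOnNhd ℝ (f j) ((↑F : Set ℝ)ᶜ)) :
    ∃ F : Finset ℝ, AnalyticOnNhd ℝ (fun t => ∑ j ∈ s, e j * f j t) ((↑F : Set ℝ)ᶜ) := by
  classical
  choose! F hF using hf
  refine ⟨s.biUnion F, fun x hx => ?_⟩
  have hx' : ∀ j ∈ s, AnalyticAt ℝ (f j) x := fun j hj => hF j hj x fun h =>
    hx (Finset.mem_coe.2 (Finset.mem_biUnion.2 ⟨j, hj, Finset.mem_coe.1 h⟩))
  clear hx hF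
  induction s using Finset.induction_on with
  | empty => simp only [Finset.sum_empty]; exact analyticAt_const
  | insert a s ha ih =>
    simp only [Finset.sum_insert ha]
    exact (analyticAt_const.mul (hx' a (Finset.mem_insert_self a s))).add
      (ih fun j hj => hx' j (Finset.mem_insert_of_mem hj))

/-- A `PR_ℂ` function is semi-analytic (analytic off the images of its rational break points). -/
theorem rpq_semiAnalytic_of_isPRC (φ : ℝ → ℂ) (F : Finset ℚ)
    (hF : ∀ a b : ℚ, a < b → (∀ r ∈ F, r ≤ a ∨ b ≤ r) →
      ∃ (P : Polynomial ℂ) (Q : Polynomial ℚ), ∀ x : ℝ, (a : ℝ) < x → x < b →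
        Polynomial.aeval (x : ℂ) Q ≠ 0 ∧ φ x = Polynomial.eval (x : ℂ) P / Polynomial.aeval (x : ℂ) Q) :
    ∃ F' : Finset ℝ, AnalyticOnNhd ℝ φ ((↑F' : Set ℝ)ᶜ) := by
  classical
  refine ⟨F.image (fun r : ℚ => (r : ℝ)), fun x hx => ?_⟩
  have hx' : ∀ r ∈ F, (r : ℝ) ≠ x := fun r hr h =>
    hx (Finset.mem_coe.2 (Finset.mem_image.2 ⟨r, hr, h⟩))
  obtain ⟨P, Q, h⟩ := rpq_rep_nhds φ F hF x hx'
  refine anCore_analyticAt_of_local_frac φ x P (Q.map (algebraMap ℚ ℂ)) (h.mono fun t ht => ?_)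
  rwa [rpq_aeval_eq_eval_map] at ht

/-- Differences of semi-analytic functions are semi-analytic. -/
theorem rpq_semiAnalytic_sub (f g : ℝ → ℂ) (hf : ∃ F : Finset ℝ, AnalyticOnNhd ℝ f ((↑F : Set ℝ)ᶜ))
    (hg : ∃ F : Finset ℝ, AnalyticOnNhd ℝ g ((↑F : Set ℝ)ᶜ)) :
    ∃ F : Finset ℝ, AnalyticOnNhd ℝ (fun t => f t - g t) ((↑F : Set ℝ)ᶜ) := by
  classical
  obtain ⟨F, hF⟩ := hf
  obtain ⟨G, hG⟩ := hg
  refine ⟨F ∪ G, fun x hx => ?_⟩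
  rw [Finset.coe_union, Set.compl_union] at hx
  exact (hF x hx.1).sub (hG x hx.2)

/-- A cofinite property pulled back along a determinant-one Möbius map is still cofinite. -/
theorem rpq_cofinite_moebius (a b c d : ℝ) (hdet : a * d - b * c = 1) (p : ℝ → Prop)
    (hp : ∀ᶠ (t : ℝ) in Filter.cofinite, p t) :
    ∀ᶠ (t : ℝ) in Filter.cofinite, p ((a * t + b) / (c * t + d)) := by
  rw [Filter.eventually_cofinite] at hp ⊢
  exact hp.preimage' fun r _ => rpq_finite_moebius_fibre a b c d hdet r

/-! ### Coefficient bookkeeping -/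

/-- Any finite family of complex numbers is a rational matrix times a `ℚ`-independent family. -/
theorem rpq_coeff_decomp {m : ℕ} (g : Fin m → ℂ) :
    ∃ (k : ℕ) (e : Fin k → ℂ) (r : Fin k → Fin m → ℚ),
      LinearIndependent ℚ e ∧ ∀ j, g j = ∑ l, e l * (r l j : ℂ) := by
  classical
  let W : Submodule ℚ ℂ := Submodule.span ℚ (Set.range g)
  haveI : Module.Finite ℚ W := Module.Finite.span_of_finite ℚ (Set.finite_range g)
  let Bs := Module.finBasis ℚ W
  have hgW : ∀ j, g j ∈ W := fun j => Submodule.subset_span ⟨j, rfl⟩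
  refine ⟨Module.finrank ℚ W, fun l => (Bs l : ℂ), fun l j => Bs.repr ⟨g j, hgW j⟩ l, ?_, fun j => ?_⟩
  · exact Bs.linearIndependent.map' W.subtype (Submodule.ker_subtype W)
  · have h1 := congrArg Subtype.val (Bs.sum_repr ⟨g j, hgW j⟩)
    simp only [AddSubmonoidClass.coe_finsetSum, SetLike.val_smul, Rat.smul_def] at h1
    rw [← h1]
    exact Finset.sum_congr rfl fun l _ => mul_comm _ _

/-- A rational relation among `ℚ`-independent functions is trivial. -/
theorem rpq_rat_relation {m : ℕ} {X : Type*} (v : Fin m → X → ℂ) (hli : LinearIndependent ℚ v)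
    (r : Fin m → ℚ) (h : ∀ x, ∑ j, (r j : ℂ) * v j x = 0) : ∀ j, r j = 0 := by
  have h' : ∑ j, r j • v j = 0 := by
    funext x
    simp only [Finset.sum_apply, Pi.smul_apply, Pi.zero_apply, Rat.smul_def]
    exact h x
  exact Fintype.linearIndependent_iff.1 hli r h'

end Summit.Langlands.Langlands.Theorems
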